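import Literature.Analysis.FluidPDE.CriticalSpaces
import Literature.Analysis.FunctionSpaces.BesovCriticalRescaling
import HarnessLib

/-!
# Navier–Stokes critical rescalings `λ U(λ ·)` of a critical Besov datum tend to zero (`λ → 0`)

Analysis/FluidPDE proof file (theorems only: no definition, no named fact, no notation).
Specialisation to physical space `ℝ³ = EuclideanSpace ℝ (Fin 3)` and to the Navier–Stokes scaling
`U ↦ λ U(λ ·)` (`rescaleDistrib`, `rescaleData` of `CriticalSpaces.lean`; Koch–Tataru 2001, §1) of
the function-space theorem `Literature.Analysis.FunctionSpaces.tendsto_rpow_smul_distribDilate_atBot`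
(`FunctionSpaces/BesovCriticalRescaling.lean`): for `U ∈ Ḃ^{-1+3/p}_{p,q}(ℝ³)`, `3 < p ≤ ∞`,
**`0 < q < ∞`**, the rescaled distributions `2^{j₀} U(2^{j₀} ·)` — all of the same critical norm
(`eHomBesovNorm_rescaleData`; the normalising exponent `d/p - s_p = 3/p - (-1 + 3/p) = 1` is the
Navier–Stokes one) — tend to `0` in `𝓢'` as `j₀ → -∞` (`tendsto_rescaleDistrib_two_zpow_atBot`);
for the distribution of a vector field `u₀ : ℝ³ → ℝ³` this reads
`∫ φ(x) (2^{j₀} u₀(2^{j₀} x)) dx → 0` for every Schwartz `φ`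
(`IsDistributionOf.tendsto_integral_smul_rescaleData_atBot`).

This is the step "the blow-up limit vanishes at the final time" of the blow-up proofs of the
critical Besov regularity criteria: D. Albritton, Anal. PDE 11 (2018) = arXiv:1612.04439, §3
Step 2, display (rescalevanish) ("`⟨u^{(n)}(·,1), φ⟩ = ⟨u(·,1), λₙ⁻² φ(·/λₙ)⟩ → 0`", with
`u^{(n)}(·,1) = λₙ u(λₙ ·, 1)`, `λₙ → 0`); W. Wang, Z. Zhang, Sci. China Math. 60 (2017) =
arXiv:1510.02589, §4 Step 2; I. Gallagher, G. S. Koch, F. Planchon, Comm. Math. Phys. 343 (2016),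
p. 5 (why `q < ∞`). It serves the discharge of
`Literature.Analysis.FluidPDE.hasSmoothExtensionPast_of_eHomBesovNorm_bounded` along either
published line (`NSCriticalClosureBesovESS.lean`, `NSCriticalClosureBesovSingleLeaf.lean`).

## References

* D. Albritton, *Blow-up criteria for the Navier–Stokes equations in non-endpoint critical Besov
  spaces*, Anal. PDE 11 (2018) 1415–1456 = arXiv:1612.04439, §3 Step 2. [Albritton2018]
* W. Wang, Z. Zhang, *Blow-up of critical norms for the 3-D Navier–Stokes equations*, Sci. China
  Math. 60 (2017) 637–650 = arXiv:1510.02589, §4 Step 2. [WangZhang2016]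
* H. Koch, D. Tataru, Adv. Math. 157 (2001) 22–35, §1 (the scaling). [KochTataru2001]
-/

noncomputable section

open MeasureTheory Filter Set Function
open _root_.Topology
open scoped SchwartzMap ENNReal NNReal

namespace Literature.Analysis.FluidPDE

open FunctionSpaces.EuclideanSpace (complexify)

/-- The critical Navier–Stokes regularity index `s_p = -1 + 3/p` lies in `(-2, 0)` for
`3 < p ≤ ∞` (`p = ∞` gives `s_∞ = -1` through `(∞).toReal = 0`). [folklore] -/
theorem neg_two_lt_criticalIndex_and_lt_zero {p : ℝ≥0∞} (hp : 3 < p) :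
    -2 < -1 + 3 / p.toReal ∧ -1 + 3 / p.toReal < 0 := by
  have h0 : (0 : ℝ) ≤ 3 / p.toReal := by positivity
  refine ⟨by linarith, ?_⟩
  rcases eq_or_ne p ⊤ with rfl | hptop
  · simp
  · have h3 : (3 : ℝ) < p.toReal := by
      have h := (ENNReal.toReal_lt_toReal (by norm_num : (3 : ℝ≥0∞) ≠ ⊤) hptop).2 hp
      simpa using h
    have : 3 / p.toReal < 1 := (div_lt_one (by linarith)).2 h3
    linarith

/-- **The critical rescalings `2^{j₀} U(2^{j₀} ·)` of `U ∈ Ḃ^{-1+3/p}_{p,q}(ℝ³)`, `q < ∞`, tend to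
`0` in `𝓢'` as `j₀ → -∞`** (Albritton 2018, §3 Step 2; Wang–Zhang 2017, §4 Step 2), for every
complex Banach target `F`, `3 < p ≤ ∞`, `0 < q < ∞`: the theorem
`FunctionSpaces.tendsto_rpow_smul_distribDilate_atBot` with `d = 3`, `s = -1 + 3/p`, where the
normalising factor `2^{j₀(d/p - s)}` is `2^{j₀}`, i.e. the map is `rescaleDistrib 2^{j₀}`.
[cite: Albritton2018, §3 Step 2] -/
theorem tendsto_rescaleDistrib_two_zpow_atBot {F : Type*} [NormedAddCommGroup F] [NormedSpace ℂ F]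
    [CompleteSpace F] {p q : ℝ≥0∞} [Fact (1 ≤ p)] (hp : 3 < p) (hq₀ : q ≠ 0) (hq : q ≠ ⊤)
    {U : 𝓢'(EuclideanSpace ℝ (Fin 3), F)}
    (hU : FunctionSpaces.MemHomBesov (-1 + 3 / p.toReal) p q U) :
    Tendsto (fun j₀ : ℤ =>
      rescaleDistrib (Units.mk0 ((2 : ℝ) ^ j₀) (zpow_ne_zero j₀ two_ne_zero)) U) atBot (𝓝 0) := by
  obtain ⟨hs, hs0⟩ := neg_two_lt_criticalIndex_and_lt_zero hp
  have key := FunctionSpaces.tendsto_rpow_smul_distribDilate_atBot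
    (E := EuclideanSpace ℝ (Fin 3)) (F := F) hs hs0 hq₀ hq hU
  refine key.congr fun j₀ => ?_
  rw [rescaleDistrib_apply, Units.val_mk0, finrank_euclideanSpace_fin]
  congr 2
  rw [show ((3 : ℕ) : ℝ) / p.toReal - (-1 + 3 / p.toReal) = 1 by push_cast; ring, mul_one,
    Real.rpow_intCast]

/-- **The same for the distribution of a vector field `u₀ : ℝ³ → ℝ³`** (Albritton 2018, §3
Step 2, "`⟨u(·,1), λₙ⁻² φ(·/λₙ)⟩ → 0`"): if `U` is the tempered distribution of `u₀` and
`U ∈ Ḃ^{-1+3/p}_{p,q}`, `3 < p ≤ ∞`, `0 < q < ∞`, then for every Schwartz `φ`,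
`∫ φ(x) · (2^{j₀} u₀(2^{j₀} x)) dx → 0` as `j₀ → -∞` (the rescaled fields `rescaleData 2^{j₀} u₀`
have distributions `rescaleDistrib 2^{j₀} U`, `IsDistributionOf.rescaleData`).
[cite: Albritton2018, §3 Step 2] -/
theorem IsDistributionOf.tendsto_integral_smul_rescaleData_atBot
    {u₀ : EuclideanSpace ℝ (Fin 3) → EuclideanSpace ℝ (Fin 3)}
    {U : 𝓢'(EuclideanSpace ℝ (Fin 3), EuclideanSpace ℂ (Fin 3))} (hU : IsDistributionOf u₀ U)
    {p q : ℝ≥0∞} [Fact (1 ≤ p)] (hp : 3 < p) (hq₀ : q ≠ 0) (hq : q ≠ ⊤)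
    (hB : FunctionSpaces.MemHomBesov (-1 + 3 / p.toReal) p q U)
    (φ : 𝓢(EuclideanSpace ℝ (Fin 3), ℂ)) :
    Tendsto (fun j₀ : ℤ => ∫ x, φ x • complexify (FluidPDE.rescaleData ((2 : ℝ) ^ j₀) u₀ x)) atBot
      (𝓝 0) := by
  have h := (PointwiseConvergenceCLM.tendsto_iff_forall_tendsto.1
    (tendsto_rescaleDistrib_two_zpow_atBot hp hq₀ hq hB)) φ
  rw [zero_apply] at h
  refine h.congr fun j₀ => ?_
  rw [((hU.rescaleData (Units.mk0 ((2 : ℝ) ^ j₀) (zpow_ne_zero j₀ two_ne_zero))) φ).2,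
    Units.val_mk0]

end Literature.Analysis.FluidPDE

end
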